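import Summits.PneNP.PneNP.Theorems.ConvexRankGatesLinAlgGateBlindGRankLogWidth
import Summits.PneNP.PneNP.Theorems.ConvexRankGatesLinAlgGateBlindGRankDecoupled
import Summits.PneNP.PneNP.Theorems.ConvexRankGatesLinAlgGateBlindGRankSpanDim
import Summits.PneNP.PneNP.Theorems.ConvexRankGatesLinAlgGateBlindTutteLogWidth
import Summits.PneNP.PneNP.Theorems.ConvexRankGatesLinAlgGateBlindMatroidInterLogWidth

/-!
# Route ConvexRankGates, crux `LinAlgGateBlind` (stmt-PneNP-10681): the union door — all unconditionally blind wide gates together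

Support theorem for the crux. The single-gate statement for a union of classes is the conjunction (`sgAt_or`), the level-`l`
host is class-agnostic, and every door of the tree sits at the same logarithmic width, so the doors COMBINE: for every `c`,
eventually in `m`, NO circuit with `≤ m^c` gates over `{∧₂, ∨₂}` together with ANY MIX of

* `PERM_d` — membership of a fixed permutation in the group generated by the live ones, `d log₂ d ≤ β(m)`;
* `GRANK_s` — generic-rank thresholds of dimension `≤ s` over any field, `s² ≤ β(m)`;
* `GRANKspan_D` — GRANK gates of ANY dimension whose matrices span `≤ D` dimensions, `D ≤ β(m)`;
* `TUTTE_d₂` — perfect matching of the live cell graph on `≤ d₂` labelled vertices, `d₂ log₂ d₂ ≤ β(m)`;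
* `MI_t` — `θ ≤ t` live inputs with both `(u_i)` and `(w_i)` independent (rank-one GRANK pencils of any dimension), `2t ≤ β(m)`,

where `β(m) = m^{7/8}/(log₂ m)^5`, computes `CLIQUE(m, ⌈m^{1/8}⌉)` (`not_computes_clique_of_isOver_union_logWidth`, unconditional).
This is the union-bound method at its limit `1 - δ = 7/8` for the crux's algebraic basis: what it does NOT cover is exactly GRANK of
dimension `m^{γ}`, `γ ≥ 7/16`, outside the listed sub-classes, and the crux's coupling `d = m^c`, `c ≥ 1`.
No new definitions. [folklore]
-/

-- `Summit.PneNP.PneNP.…` duplicates `PneNP` BY DESIGN (single-problem summit).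
set_option linter.dupNamespace false

noncomputable section

namespace Summit.PneNP.PneNP.Theorems

open Finset Filter Literature.Computability.Complexity Razborov
open Summit.PneNP.PneNP.Cruxes.LinAlgGateBlind.DnfInvariantWideGatesSeeSmallCliques
open Summit.PneNP.PneNP.Cruxes.LinAlgGateBlind.DnfInvariantWideGatesSeeSmallCliques.DenseRegime

/-- **The union door (unconditional).** For every `c`, eventually in `m`, for all `d s D d₂ t` in the ranges
`d log₂ d ≤ β`, `s² ≤ β`, `D ≤ β`, `d₂ log₂ d₂ ≤ β`, `2t ≤ β` (`β = m^{7/8}/(log₂ m)^5`) and every circuit `C` with `≤ m^c` gates over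
`{∧₂, ∨₂} ∪ PERM_d ∪ GRANK_s ∪ GRANKspan_D ∪ TUTTE_{d₂} ∪ MI_t` (classes as in `sgAt_perm_logWidth`, `sgAt_gRank_logWidth`,
`sgAt_gRankSpan_logWidth`, `sgAt_tutte_logWidth`, `sgAt_matroidInter_logWidth`): `¬ C.Computes CLIQUE(m, ⌈m^{1/8}⌉)` — the level-`l`
host `not_computes_clique_of_collapse_level` with the five collapses and `sgAt_or`. [folklore] -/
theorem not_computes_clique_of_isOver_union_logWidth : ∀ c : ℕ, ∀ᶠ m : ℕ in atTop, ∀ d s D d₂ t : ℕ,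
    (d : ℝ) * Real.logb 2 d ≤ (m : ℝ) ^ (7 / 8 : ℝ) / Real.logb 2 m ^ 5 →
    (s : ℝ) ^ 2 ≤ (m : ℝ) ^ (7 / 8 : ℝ) / Real.logb 2 m ^ 5 →
    (D : ℝ) ≤ (m : ℝ) ^ (7 / 8 : ℝ) / Real.logb 2 m ^ 5 →
    (d₂ : ℝ) * Real.logb 2 d₂ ≤ (m : ℝ) ^ (7 / 8 : ℝ) / Real.logb 2 m ^ 5 →
    2 * (t : ℝ) ≤ (m : ℝ) ^ (7 / 8 : ℝ) / Real.logb 2 m ^ 5 →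
    ∀ C : Circuit (KEdge m), C.IsOver ({GateFn.and 2, GateFn.or 2} ∪
      {g : GateFn | IsPermGate d g ∨ IsGRankGate s g ∨
        (∃ (F : Type) (_ : Field F) (d' θ : ℕ) (K₀ : Matrix (Fin d') (Fin d') F) (K : Fin g.1 → Matrix (Fin d') (Fin d') F),
          Module.finrank F (Submodule.span F (Set.range K)) ≤ D ∧
            ∀ v : Fin g.1 → Bool, g.2 v = true ↔ θ ≤ (symbolicMatrix K₀ K v).rank) ∨
        (∃ d' : ℕ, d' ≤ d₂ ∧ ∃ (P₀ : Set (Fin d' × Fin d')) (P : Fin g.1 → Set (Fin d' × Fin d')),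
          ∀ v : Fin g.1 → Bool, g.2 v = true ↔
            ∃ M : (SimpleGraph.fromRel fun a b : Fin d' =>
              (a, b) ∈ {x : Fin d' × Fin d' | x ∈ P₀ ∨ ∃ i, v i = true ∧ x ∈ P i}).Subgraph, M.IsPerfectMatching) ∨
        (∃ (F : Type) (_ : DivisionRing F) (D' θ : ℕ), θ ≤ t ∧ ∃ u w : Fin g.1 → (Fin D' → F),
          ∀ v : Fin g.1 → Bool, g.2 v = true ↔ ∃ I : Finset (Fin g.1), (∀ i ∈ I, v i = true) ∧ #I = θ ∧
            Module.finrank F (Submodule.span F (u '' (I : Set (Fin g.1)))) = θ ∧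
            Module.finrank F (Submodule.span F (w '' (I : Set (Fin g.1)))) = θ)}) →
      C.size ≤ m ^ c → ¬ C.Computes (cliqueFn m ⌈(m : ℝ) ^ (1 / 8 : ℝ)⌉₊) := by
  intro c
  filter_upwards [not_computes_clique_of_collapse_level c, sgAt_perm_logWidth c, sgAt_gRank_logWidth c,
    sgAt_gRankSpan_logWidth c, sgAt_tutte_logWidth c, sgAt_matroidInter_logWidth c, logWidth_le_lOf c]
    with m hhost hSGp hSGg hSGs hSGt hSGm hLl d s D d₂ t hd hs hD hd₂ ht C hC hsize
  -- the five term-gate classes, as predicates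
  set Pp : GateFn → Prop := IsPermGate d with hPp
  set Pg : GateFn → Prop := IsGRankGate s with hPg
  set Ps : GateFn → Prop := fun g => ∃ (F : Type) (_ : Field F) (d' θ : ℕ) (K₀ : Matrix (Fin d') (Fin d') F)
    (K : Fin g.1 → Matrix (Fin d') (Fin d') F), Module.finrank F (Submodule.span F (Set.range K)) ≤ D ∧
      ∀ v : Fin g.1 → Bool, g.2 v = true ↔ θ ≤ (symbolicMatrix K₀ K v).rank with hPs
  set Pt : GateFn → Prop := fun g => ∃ d' : ℕ, d' ≤ d₂ ∧ ∃ (P₀ : Set (Fin d' × Fin d'))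
    (P : Fin g.1 → Set (Fin d' × Fin d')), ∀ v : Fin g.1 → Bool, g.2 v = true ↔
      ∃ M : (SimpleGraph.fromRel fun a b : Fin d' =>
        (a, b) ∈ {x : Fin d' × Fin d' | x ∈ P₀ ∨ ∃ i, v i = true ∧ x ∈ P i}).Subgraph, M.IsPerfectMatching with hPt
  set Pm : GateFn → Prop := fun g => ∃ (F : Type) (_ : DivisionRing F) (D' θ : ℕ), θ ≤ t ∧
    ∃ u w : Fin g.1 → (Fin D' → F), ∀ v : Fin g.1 → Bool, g.2 v = true ↔ ∃ I : Finset (Fin g.1),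
      (∀ i ∈ I, v i = true) ∧ #I = θ ∧ Module.finrank F (Submodule.span F (u '' (I : Set (Fin g.1)))) = θ ∧
        Module.finrank F (Submodule.span F (w '' (I : Set (Fin g.1)))) = θ with hPm
  set Pall : GateFn → Prop := fun g => Pp g ∨ Pg g ∨ Ps g ∨ Pt g ∨ Pm g with hPall
  have hSG : SGAt m Pall ((2 * c + 8) * (Nat.log 2 m + 1)) (kOf m) (qOf m) (epsOf c m) :=
    sgAt_or (hSGp d hd) (sgAt_or (hSGg s hs) (sgAt_or (hSGs D hD) (sgAt_or (hSGt d₂ hd₂) (hSGm t ht))))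
  refine hhost ((2 * c + 8) * (Nat.log 2 m + 1)) (Nat.le_mul_of_pos_right _ (Nat.succ_pos _)) hLl
    {g | Pall g} Pall (fun g hg => ?_) (fun g hg A hA => ?_) hSG C hC hsize
  · -- monotonicity, class by class
    rcases hg with hg | hg | hg | hg | hg
    · exact IsPermGate.monotone hg
    · exact IsGRankGate.monotone hg
    · obtain ⟨F, _, d', θ, K₀, K, -, hgK⟩ := hg
      exact IsGRankGate.monotone ⟨F, inferInstance, d', θ, le_rfl, K₀, K, hgK⟩
    · obtain ⟨d', -, P₀, P, hgP⟩ := hg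
      exact monotone_of_tutte g P₀ P hgP
    · obtain ⟨F, _, D', θ, -, u, w, hgu⟩ := hg
      exact monotone_of_matroidInter g u w hgu
  · -- collapse, class by class
    rcases hg with hg | hg | hg | hg | hg
    · exact isTermGate_mono (fun _ h' => Or.inl h') ((stub_termCollapse m d _ g A hA).1 hg)
    · exact isTermGate_mono (fun _ h' => Or.inr (Or.inl h')) ((stub_termCollapse m s _ g A hA).2 hg)
    · exact isTermGate_mono (fun _ h' => Or.inr (Or.inr (Or.inl h'))) (isTermGate_gRankSpan_collapse m _ D g A hA hg)
    · exact isTermGate_mono (fun _ h' => Or.inr (Or.inr (Or.inr (Or.inl h')))) (isTermGate_tutte_collapse m _ d₂ g A hA hg)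
    · exact isTermGate_mono (fun _ h' => Or.inr (Or.inr (Or.inr (Or.inr h')))) (isTermGate_matroidInter_collapse m _ t g A hA hg)

/-! ### One real exponent `γ < 7/8` for the whole union -/

/-- Eventually `2⌊m^γ⌋ ≤ m^{7/8}/(log₂ m)^5` for every `γ < 7/8`. [folklore] -/
theorem eventually_two_mul_floor_rpow_le {γ : ℝ} (hγ : γ < 7 / 8) :
    ∀ᶠ m : ℕ in atTop, 2 * ((⌊(m : ℝ) ^ γ⌋₊ : ℕ) : ℝ) ≤ (m : ℝ) ^ (7 / 8 : ℝ) / Real.logb 2 m ^ 5 := by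
  have hη : 0 < 7 / 8 - γ := by linarith
  filter_upwards [eventually_logb_pow_le_rpow 6 hη, eventually_ge_atTop 4] with m hlog hm4
  have hmpos : (0 : ℝ) < m := by exact_mod_cast (show 0 < m by omega)
  have hℓ2 : 2 ≤ Real.logb 2 m := by
    rw [Real.le_logb_iff_rpow_le one_lt_two hmpos]
    norm_num
    exact_mod_cast hm4
  have hℓ5 : 0 < Real.logb 2 m ^ 5 := by positivity
  have h0 : (0 : ℝ) ≤ (m : ℝ) ^ γ := Real.rpow_nonneg (Nat.cast_nonneg m) _
  have hdle : ((⌊(m : ℝ) ^ γ⌋₊ : ℕ) : ℝ) ≤ (m : ℝ) ^ γ := Nat.floor_le h0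
  rw [le_div_iff₀ hℓ5]
  calc 2 * ((⌊(m : ℝ) ^ γ⌋₊ : ℕ) : ℝ) * Real.logb 2 m ^ 5 ≤ 2 * (m : ℝ) ^ γ * Real.logb 2 m ^ 5 := by gcongr
    _ ≤ Real.logb 2 m * (m : ℝ) ^ γ * Real.logb 2 m ^ 5 := by gcongr
    _ = (m : ℝ) ^ γ * Real.logb 2 m ^ 6 := by ring
    _ ≤ (m : ℝ) ^ γ * (m : ℝ) ^ (7 / 8 - γ) := mul_le_mul_of_nonneg_left hlog h0
    _ = (m : ℝ) ^ (7 / 8 : ℝ) := by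
        rw [← Real.rpow_add hmpos]
        norm_num

/-- **The union door with one real exponent (unconditional).** For every `c` and every `γ < 7/8`, eventually in `m`: no circuit
with `≤ m^c` gates over `{∧₂, ∨₂} ∪ PERM_{⌊m^γ⌋} ∪ GRANK_{⌊m^{γ/2}⌋} ∪ GRANKspan_{⌊m^γ⌋} ∪ TUTTE_{⌊m^γ⌋} ∪ MI_{⌊m^γ⌋}` computes
`CLIQUE(m, ⌈m^{1/8}⌉)` — the crux's algebraic basis with the gate parameter DECOUPLED from the size exponent, at the union-bound limit
`7/8` for every listed class (general GRANK at `7/16`, parameter `⌊m^{γ/2}⌋`). (`not_computes_clique_of_isOver_union_logWidth` with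
`eventually_floor_rpow_mul_logb_le`, `eventually_floor_rpow_sq_le`, `eventually_two_mul_floor_rpow_le`.) [folklore] -/
theorem not_computes_clique_of_isOver_union_rpow : ∀ (c : ℕ) (γ : ℝ), γ < 7 / 8 → ∀ᶠ m : ℕ in atTop,
    ∀ C : Circuit (KEdge m), C.IsOver ({GateFn.and 2, GateFn.or 2} ∪
      {g : GateFn | IsPermGate ⌊(m : ℝ) ^ γ⌋₊ g ∨ IsGRankGate ⌊(m : ℝ) ^ (γ / 2)⌋₊ g ∨
        (∃ (F : Type) (_ : Field F) (d' θ : ℕ) (K₀ : Matrix (Fin d') (Fin d') F) (K : Fin g.1 → Matrix (Fin d') (Fin d') F),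
          Module.finrank F (Submodule.span F (Set.range K)) ≤ ⌊(m : ℝ) ^ γ⌋₊ ∧
            ∀ v : Fin g.1 → Bool, g.2 v = true ↔ θ ≤ (symbolicMatrix K₀ K v).rank) ∨
        (∃ d' : ℕ, d' ≤ ⌊(m : ℝ) ^ γ⌋₊ ∧ ∃ (P₀ : Set (Fin d' × Fin d')) (P : Fin g.1 → Set (Fin d' × Fin d')),
          ∀ v : Fin g.1 → Bool, g.2 v = true ↔
            ∃ M : (SimpleGraph.fromRel fun a b : Fin d' =>
              (a, b) ∈ {x : Fin d' × Fin d' | x ∈ P₀ ∨ ∃ i, v i = true ∧ x ∈ P i}).Subgraph, M.IsPerfectMatching) ∨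
        (∃ (F : Type) (_ : DivisionRing F) (D' θ : ℕ), θ ≤ ⌊(m : ℝ) ^ γ⌋₊ ∧ ∃ u w : Fin g.1 → (Fin D' → F),
          ∀ v : Fin g.1 → Bool, g.2 v = true ↔ ∃ I : Finset (Fin g.1), (∀ i ∈ I, v i = true) ∧ #I = θ ∧
            Module.finrank F (Submodule.span F (u '' (I : Set (Fin g.1)))) = θ ∧
            Module.finrank F (Submodule.span F (w '' (I : Set (Fin g.1)))) = θ)}) →
      C.size ≤ m ^ c → ¬ C.Computes (cliqueFn m ⌈(m : ℝ) ^ (1 / 8 : ℝ)⌉₊) := by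
  intro c γ hγ
  have hγ2 : γ / 2 < 7 / 16 := by linarith
  filter_upwards [not_computes_clique_of_isOver_union_logWidth c, eventually_floor_rpow_mul_logb_le hγ,
    eventually_floor_rpow_sq_le hγ2, eventually_two_mul_floor_rpow_le hγ] with m hm hdlog hsq h2 C hC hsize
  have hD : ((⌊(m : ℝ) ^ γ⌋₊ : ℕ) : ℝ) ≤ (m : ℝ) ^ (7 / 8 : ℝ) / Real.logb 2 m ^ 5 := by
    have : (0 : ℝ) ≤ ((⌊(m : ℝ) ^ γ⌋₊ : ℕ) : ℝ) := Nat.cast_nonneg _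
    linarith
  exact hm _ _ _ _ _ hdlog hsq hD hdlog h2 C hC hsize

end Summit.PneNP.PneNP.Theorems

end
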